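import Summits.ABC.ABC.Theorems.IUTThetaPilotGenEllTwoMenuCovering

set_option linter.dupNamespace false -- `Summit.ABC.ABC.…`: summit = problem = `ABC` (cell layout)

/-!
# Route `route-ABC-IUTThetaPilot`, support item `GenEllTwo` (stmt-ABC-19679) — helper:
# the NESTED (depth-`k`) menu covering lemma

S. Mochizuki, *Arithmetic elliptic curves in general position*, Math. J. Okayama Univ. **52** (2010)
[cite: MochizukiGenEll2010], proof of Thm. 2.1, p. 12.  In the number-field-only architecture for
`GenEllTwo` (cell abc-iut, GENELLTWO-P1ROUTE §4) the compactness step is replaced by a FINITE MENU of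
cusp-preserving self-maps of `ℙ¹` and a pigeonhole over the conjugate slots of a point.  The sibling file
`IUTThetaPilotGenEllTwoMenuCovering` (abc-iut-w5-d046) proves the DEPTH-2 case, which is not enough in
general (if the bad set `X ∋ ζ₆`, a primitive sixth root of unity, the families `y ↦ y^p`, `y ↦ 1−(1−y)^n`
violate its inner disjointness hypothesis at `y₀ = 1 − ζ₆ = ζ₆⁻¹` for every pair of exponents prime to
`6`); §4's "depth `≤ 4`, no point on 4 loci" needs the depth-`k` NESTED version proved here, re-using the
depth-2 file's separation / localisation lemmas:

* levels `j = 0, …, k − 1` (level `0` is applied FIRST to the slots), a common parameter type `α`,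
  menus `P j : Finset α`, families `f j : α → E → E` of self-maps of a metric space `E`, and a chain of
  sets `S : ℕ → Set E` with `S k = X` (the bad set) and `S 0 = ∅` (no persistent point at full depth);
  per level the three hypotheses of the depth-2 file: finite preimages `(f j p)⁻¹(S (j+1))`, cross-member
  PERSISTENCE `f j p y ∈ S (j+1) ∧ f j p' y ∈ S (j+1) ⇒ y ∈ S j` (`p ≠ p'`), and localisation of `f j p`
  at `S (j+1)`;
* `exists_step_radius`, `exists_radii_chain` — radii `ρ 0, …, ρ k > 0`, produced from the WHOLE menu
  (hence "after the menu"), with the level implications "two `ρ (j+1)`-near images in `S (j+1)` ⇒ the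
  point is `ρ j`-near `S j`";
* `exists_good_menu_abstract` — the nested pigeonhole over an arbitrary slot type (induction on `k`:
  a slot not near `S j` forbids at most one member of `P j`; `#slots < #(P j)` for every `j`);
* `exists_good_menu` (one slot space), `exists_good_menu₂` (two slot spaces sharing the parameter
  choice — conjugates at `∞` in `ℂ` and at `2` in `Q̄₂`) and `exists_good_menu_family` (any family of
  slot spaces `Σ v, E v`, e.g. one per place of `{∞} ∪ S_bad`): radii `r > 0` fixed BEFORE the slots
  such that for all slot sets smaller than every menu some choice `c j ∈ P j` makes the full composite
  `f (k−1) (c (k−1)) ∘ ⋯ ∘ f 0 (c 0)` of EVERY slot `r`-far from `X`.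

For `k = 2`, `S 1 := T`, this is the depth-2 statement (its inner disjointness hypothesis is persistence
into `S 0 = ∅`).  HELPER LEMMAS (`--supports stmt-ABC-19679`), not a closing theorem; proof-only (no
definitions): the composite of the first `j` levels for the parameter choice `c` is written with Mathlib's
`List.foldl` as `(List.range j).foldl (fun s i => g i (c i) s) s₀` (unfolding lemmas `comp_zero`,
`comp_succ`).  The parameter type `α` is assumed inhabited (exponents: `ℕ`).  Classical and undisputed;
nothing here bears on [IUTchIII] Cor. 3.12.
-/

noncomputable section

open Metric

namespace Summit.ABC.ABC.Theorems.GenEllTwo.MenuCoveringNested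

open Summit.ABC.ABC.Theorems.GenEllTwo.MenuCovering

/-! ### The composite of the first `j` levels, as a `List.foldl` over `List.range j` -/

section Iterate

variable {α σ : Type*}

/-- No level applied: the slot is unchanged. [cite: MochizukiGenEll2010, Thm 2.1 p.12] -/
theorem comp_zero (g : ℕ → α → σ → σ) (c : ℕ → α) (s : σ) :
    (List.range 0).foldl (fun s i => g i (c i) s) s = s := by
  simp [List.range_zero]

/-- After `j + 1` levels the slot is `g j (c j)` applied to its state after `j` levels.
[cite: MochizukiGenEll2010, Thm 2.1 p.12] -/
theorem comp_succ (g : ℕ → α → σ → σ) (c : ℕ → α) (j : ℕ) (s : σ) :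
    (List.range (j + 1)).foldl (fun s i => g i (c i) s) s =
      g j (c j) ((List.range j).foldl (fun s i => g i (c i) s) s) := by
  rw [List.range_succ, List.foldl_append, List.foldl_cons, List.foldl_nil]

/-- The composite of the first `j` levels only depends on the parameters below `j`.
[cite: MochizukiGenEll2010, Thm 2.1 p.12] -/
theorem comp_congr (g : ℕ → α → σ → σ) {c c' : ℕ → α} {j : ℕ} (h : ∀ i < j, c i = c' i) (s : σ) :
    (List.range j).foldl (fun s i => g i (c i) s) s = (List.range j).foldl (fun s i => g i (c' i) s) s := by
  induction j with
  | zero => rw [comp_zero, comp_zero]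
  | succ j ih =>
    rw [comp_succ, comp_succ, ih (fun i hi => h i (Nat.lt_succ_of_lt hi)), h j (Nat.lt_succ_self j)]

/-- Compatibility of the composite with a map of slot types intertwining the level maps (used for the
`Sum`-encoding of two slot spaces). [cite: MochizukiGenEll2010, Thm 2.1 p.12] -/
theorem comp_map {τ : Type*} (g : ℕ → α → σ → σ) (g' : ℕ → α → τ → τ) (φ : σ → τ)
    (h : ∀ j a s, φ (g j a s) = g' j a (φ s)) (c : ℕ → α) (j : ℕ) (s : σ) :
    φ ((List.range j).foldl (fun s i => g i (c i) s) s) =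
      (List.range j).foldl (fun t i => g' i (c i) t) (φ s) := by
  induction j with
  | zero => rw [comp_zero, comp_zero]
  | succ j ih => rw [comp_succ, comp_succ, h, ih]

end Iterate

/-! ### The nested pigeonhole (pure combinatorics) -/

section Pigeonhole

variable {α σ : Type*}

/-- **Nested pigeonhole, abstract form.**  Levels `j < k` with menus `P j`, level maps `g j a` on a slot
type `σ`, and "nearness" predicates `Near j`; hypothesis: a slot that is NOT `Near j` forbids at most one
member of `P j` (i.e. two members sending it `Near (j+1)` coincide).  If no initial slot is `Near 0` and
every menu is larger than the number of slots, some parameter choice `c` (`c j ∈ P j`) keeps every slot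
NOT `Near k` after all `k` levels. [cite: MochizukiGenEll2010, Thm 2.1 p.12] -/
theorem exists_good_menu_abstract [Inhabited α] (k : ℕ) (P : ℕ → Finset α) (g : ℕ → α → σ → σ)
    (Near : ℕ → σ → Prop)
    (hstep : ∀ j < k, ∀ s, ¬ Near j s → ∀ p ∈ P j, ∀ p' ∈ P j,
      Near (j + 1) (g j p s) → Near (j + 1) (g j p' s) → p = p')
    (Z : Finset σ) (hZ0 : ∀ s ∈ Z, ¬ Near 0 s) (hcard : ∀ j < k, Z.card < (P j).card) :
    ∃ c : ℕ → α, (∀ j < k, c j ∈ P j) ∧ ∀ s ∈ Z, ¬ Near k ((List.range k).foldl (fun s i => g i (c i) s) s) := by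
  classical
  induction k with
  | zero =>
    -- no level: any parameter function works
    refine ⟨fun _ => default, fun j hj => absurd hj (Nat.not_lt_zero j), fun s hs => ?_⟩
    rw [comp_zero]
    exact hZ0 s hs
  | succ k ih =>
    obtain ⟨c, hcP, hgood⟩ := ih (fun j hj => hstep j (Nat.lt_succ_of_lt hj))
      (fun j hj => hcard j (Nat.lt_succ_of_lt hj))
    -- the slots after `k` levels, none of them `Near k`
    let Z' : Finset σ := Z.image fun s => (List.range k).foldl (fun s i => g i (c i) s) s
    have hZ' : ∀ s' ∈ Z', ¬ Near k s' := by
      intro s' hs'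
      obtain ⟨s, hs, rfl⟩ := Finset.mem_image.mp hs'
      exact hgood s hs
    -- the members of `P k` forbidden by some slot: at most one per slot
    let B : Finset α := Z'.biUnion fun s' => (P k).filter fun p => Near (k + 1) (g k p s')
    have hB' : B.card ≤ Z'.card := by
      refine le_trans Finset.card_biUnion_le ?_
      calc ∑ s' ∈ Z', ((P k).filter fun p => Near (k + 1) (g k p s')).card ≤ ∑ _s' ∈ Z', 1 :=
            Finset.sum_le_sum fun s' hs' => Finset.card_le_one.mpr fun p hp p' hp' => by
              rw [Finset.mem_filter] at hp hp'
              exact hstep k (Nat.lt_succ_self k) s' (hZ' s' hs') p hp.1 p' hp'.1 hp.2 hp'.2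
        _ = Z'.card := by simp
    have hB : B.card ≤ Z.card := hB'.trans Finset.card_image_le
    obtain ⟨pk, hpkP, hpkB⟩ : ∃ p ∈ P k, p ∉ B := by
      by_contra hcon
      push Not at hcon
      have h1 : (P k).card ≤ B.card := Finset.card_le_card fun p hp => hcon p hp
      have h2 := hcard k (Nat.lt_succ_self k)
      omega
    -- the new parameter function
    refine ⟨Function.update c k pk, fun j hj => ?_, fun s hs => ?_⟩
    · by_cases hjk : j < k
      · have h1 : Function.update c k pk j = c j := Function.update_of_ne (Nat.ne_of_lt hjk) _ _
        rw [h1]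
        exact hcP j hjk
      · have hjk' : j = k := by omega
        rw [hjk']
        have h1 : Function.update c k pk k = pk := by simp
        rw [h1]
        exact hpkP
    · have hit : (List.range k).foldl (fun s i => g i (Function.update c k pk i) s) s =
          (List.range k).foldl (fun s i => g i (c i) s) s :=
        comp_congr g (fun i hi => Function.update_of_ne (Nat.ne_of_lt hi) _ _) s
      have hck : Function.update c k pk k = pk := by simp
      rw [comp_succ, hck, hit]
      intro hnear
      apply hpkB
      simp only [B, Z', Finset.mem_biUnion, Finset.mem_filter, Finset.mem_image]
      exact ⟨(List.range k).foldl (fun s i => g i (c i) s) s, ⟨s, hs, rfl⟩, hpkP, hnear⟩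

end Pigeonhole

/-! ### The radii chain (one slot space) -/

section Metric

variable {E α : Type*} [MetricSpace E]

/-- **One level of radii.**  For a menu `P` of self-maps `f p` with finite preimages of `Snext`,
cross-member persistence into `S` and localisation at `Snext`, and a prescribed radius `ρ > 0` for
nearness to `S`: some `ρ' > 0` such that a point with two `ρ'`-near images in `Snext` (under distinct
members) is `ρ`-near `S`. [cite: MochizukiGenEll2010, Thm 2.1 p.12] -/
theorem exists_step_radius (P : Finset α) (f : α → E → E) (S Snext : Set E)
    (hfin : ∀ p ∈ P, (f p ⁻¹' Snext).Finite)
    (hpers : ∀ p ∈ P, ∀ p' ∈ P, p ≠ p' → ∀ y, f p y ∈ Snext → f p' y ∈ Snext → y ∈ S)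
    (hloc : ∀ p ∈ P, ∀ ε > 0, ∃ δ > 0, ∀ u, (∃ x ∈ Snext, dist (f p u) x < δ) →
      ∃ y ∈ f p ⁻¹' Snext, dist u y < ε)
    {ρ : ℝ} (hρ : 0 < ρ) :
    ∃ ρ' > 0, ∀ u, ∀ p ∈ P, ∀ p' ∈ P, p ≠ p' →
      (∃ x ∈ Snext, dist (f p u) x < ρ') → (∃ x ∈ Snext, dist (f p' u) x < ρ') →
        ∃ x ∈ S, dist u x < ρ := by
  -- separation of the union of the preimage sets
  have hU : (⋃ p ∈ P, f p ⁻¹' Snext).Finite :=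
    Set.Finite.biUnion P.finite_toSet (fun p hp => hfin p hp)
  obtain ⟨η, hη, hsep⟩ := exists_separation hU
  -- uniform localisation at radius `min ρ η`
  obtain ⟨δ, hδ, hlocu⟩ := exists_uniform_delta P f Snext hloc (lt_min hρ hη)
  refine ⟨δ, hδ, fun u p hp p' hp' hne hu hu' => ?_⟩
  obtain ⟨y, hy, hdy⟩ := hlocu p hp u hu
  obtain ⟨y', hy', hdy'⟩ := hlocu p' hp' u hu'
  have hyU : y ∈ ⋃ p ∈ P, f p ⁻¹' Snext := Set.mem_biUnion hp hy
  have hy'U : y' ∈ ⋃ p ∈ P, f p ⁻¹' Snext := Set.mem_biUnion hp' hy'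
  have hd : dist y y' < 2 * η := by
    calc dist y y' ≤ dist y u + dist u y' := dist_triangle _ _ _
      _ = dist u y + dist u y' := by rw [dist_comm y u]
      _ < min ρ η + min ρ η := add_lt_add hdy hdy'
      _ ≤ η + η := add_le_add (min_le_right _ _) (min_le_right _ _)
      _ = 2 * η := by ring
  have hyy' : y = y' := hsep y hyU y' hy'U hd
  subst hyy'
  exact ⟨y, hpers p hp p' hp' hne y hy hy', lt_of_lt_of_le hdy (min_le_left _ _)⟩

/-- **The radii chain.**  For levels `j < k` as in the module docstring there are radii `ρ j > 0`
(`j` arbitrary, only `j ≤ k` matter) such that at every level `j < k`: a point with two `ρ (j+1)`-near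
images in `S (j+1)` under distinct members of `P j` is `ρ j`-near `S j`.  All radii are produced from the
menus, the maps and the sets alone ("radii after the menu"). [cite: MochizukiGenEll2010, Thm 2.1 p.12] -/
theorem exists_radii_chain (k : ℕ) (P : ℕ → Finset α) (f : ℕ → α → E → E) (S : ℕ → Set E)
    (hfin : ∀ j < k, ∀ p ∈ P j, (f j p ⁻¹' S (j + 1)).Finite)
    (hpers : ∀ j < k, ∀ p ∈ P j, ∀ p' ∈ P j, p ≠ p' → ∀ y,
      f j p y ∈ S (j + 1) → f j p' y ∈ S (j + 1) → y ∈ S j)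
    (hloc : ∀ j < k, ∀ p ∈ P j, ∀ ε > 0, ∃ δ > 0, ∀ u, (∃ x ∈ S (j + 1), dist (f j p u) x < δ) →
      ∃ y ∈ f j p ⁻¹' S (j + 1), dist u y < ε) :
    ∃ ρ : ℕ → ℝ, (∀ j, 0 < ρ j) ∧ ∀ j < k, ∀ u, ∀ p ∈ P j, ∀ p' ∈ P j, p ≠ p' →
      (∃ x ∈ S (j + 1), dist (f j p u) x < ρ (j + 1)) →
      (∃ x ∈ S (j + 1), dist (f j p' u) x < ρ (j + 1)) → ∃ x ∈ S j, dist u x < ρ j := by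
  induction k with
  | zero => exact ⟨fun _ => 1, fun _ => one_pos, fun j hj => absurd hj (Nat.not_lt_zero j)⟩
  | succ k ih =>
    obtain ⟨ρ, hρ, hchain⟩ := ih (fun j hj => hfin j (Nat.lt_succ_of_lt hj))
      (fun j hj => hpers j (Nat.lt_succ_of_lt hj)) (fun j hj => hloc j (Nat.lt_succ_of_lt hj))
    obtain ⟨ρ', hρ', hk⟩ := exists_step_radius (P k) (f k) (S k) (S (k + 1))
      (hfin k (Nat.lt_succ_self k)) (hpers k (Nat.lt_succ_self k)) (hloc k (Nat.lt_succ_self k)) (hρ k)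
    refine ⟨Function.update ρ (k + 1) ρ', fun j => ?_, fun j hj => ?_⟩
    · by_cases hjk : j = k + 1
      · rw [hjk]
        have h1 : Function.update ρ (k + 1) ρ' (k + 1) = ρ' := by simp
        rw [h1]
        exact hρ'
      · have h1 : Function.update ρ (k + 1) ρ' j = ρ j := Function.update_of_ne hjk _ _
        rw [h1]
        exact hρ j
    · by_cases hjk : j < k
      · -- a lower level: both radii unchanged
        have h1 : Function.update ρ (k + 1) ρ' (j + 1) = ρ (j + 1) :=
          Function.update_of_ne (by omega) _ _
        have h2 : Function.update ρ (k + 1) ρ' j = ρ j := Function.update_of_ne (by omega) _ _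
        rw [h1, h2]
        exact hchain j hjk
      · -- the top level `j = k`
        have hjk' : j = k := by omega
        rw [hjk']
        have h1 : Function.update ρ (k + 1) ρ' (k + 1) = ρ' := by simp
        have h2 : Function.update ρ (k + 1) ρ' k = ρ k := Function.update_of_ne (by omega) _ _
        rw [h1, h2]
        exact hk

/-- **NESTED MENU COVERING LEMMA, one slot space.**  Levels `j < k`, menus `P j`, families `f j` of
self-maps of `E`, sets `S` with `S 0 = ∅` and the three per-level hypotheses (finite preimages,
cross-member persistence `S (j+1) ⇝ S j`, localisation).  Then there is `r > 0` (depending only on these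
data) such that for every finite slot set `Z` smaller than every menu, some choice `c j ∈ P j` makes the
full composite of every slot `r`-far from `S k`. [cite: MochizukiGenEll2010, Thm 2.1 p.12] -/
theorem exists_good_menu [Inhabited α] (k : ℕ) (P : ℕ → Finset α) (f : ℕ → α → E → E) (S : ℕ → Set E)
    (hS0 : S 0 = ∅)
    (hfin : ∀ j < k, ∀ p ∈ P j, (f j p ⁻¹' S (j + 1)).Finite)
    (hpers : ∀ j < k, ∀ p ∈ P j, ∀ p' ∈ P j, p ≠ p' → ∀ y,
      f j p y ∈ S (j + 1) → f j p' y ∈ S (j + 1) → y ∈ S j)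
    (hloc : ∀ j < k, ∀ p ∈ P j, ∀ ε > 0, ∃ δ > 0, ∀ u, (∃ x ∈ S (j + 1), dist (f j p u) x < δ) →
      ∃ y ∈ f j p ⁻¹' S (j + 1), dist u y < ε) :
    ∃ r > 0, ∀ Z : Finset E, (∀ j < k, Z.card < (P j).card) →
      ∃ c : ℕ → α, (∀ j < k, c j ∈ P j) ∧
        ∀ z ∈ Z, ∀ x ∈ S k, r ≤ dist ((List.range k).foldl (fun z i => f i (c i) z) z) x := by
  obtain ⟨ρ, hρ, hchain⟩ := exists_radii_chain k P f S hfin hpers hloc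
  refine ⟨ρ k, hρ k, fun Z hZ => ?_⟩
  obtain ⟨c, hc, hgood⟩ := exists_good_menu_abstract k P f
    (fun j u => ∃ x ∈ S j, dist u x < ρ j)
    (fun j hj s hs p hp p' hp' hn hn' => by
      by_contra hne
      exact hs (hchain j hj s p hp p' hp' hne hn hn'))
    Z (fun s _ => by simp [hS0]) hZ
  refine ⟨c, hc, fun z hz x hx => ?_⟩
  by_contra hlt
  exact hgood z hz ⟨x, hx, lt_of_not_ge hlt⟩

/-- **NESTED MENU COVERING LEMMA, two slot spaces** (the case of `GenEllTwo`: conjugates at `∞`, in `ℂ`,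
and at `2`, in `Q̄₂`, moved by the SAME parameter choice): with the per-level hypotheses in each space
(`S₁ 0 = ∅ = S₂ 0`), there are radii `r₁, r₂ > 0` such that for all slot sets with
`#Z₁ + #Z₂ < #(P j)` for every `j`, some `c j ∈ P j` makes the full composite of every slot of `Z₁`
`r₁`-far from `S₁ k` and of every slot of `Z₂` `r₂`-far from `S₂ k`.
[cite: MochizukiGenEll2010, Thm 2.1 p.12] -/
theorem exists_good_menu₂ {E₁ E₂ : Type*} [MetricSpace E₁] [MetricSpace E₂] [Inhabited α]
    (k : ℕ) (P : ℕ → Finset α)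
    (f₁ : ℕ → α → E₁ → E₁) (S₁ : ℕ → Set E₁) (hS₁ : S₁ 0 = ∅)
    (hfin₁ : ∀ j < k, ∀ p ∈ P j, (f₁ j p ⁻¹' S₁ (j + 1)).Finite)
    (hpers₁ : ∀ j < k, ∀ p ∈ P j, ∀ p' ∈ P j, p ≠ p' → ∀ y,
      f₁ j p y ∈ S₁ (j + 1) → f₁ j p' y ∈ S₁ (j + 1) → y ∈ S₁ j)
    (hloc₁ : ∀ j < k, ∀ p ∈ P j, ∀ ε > 0, ∃ δ > 0, ∀ u, (∃ x ∈ S₁ (j + 1), dist (f₁ j p u) x < δ) →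
      ∃ y ∈ f₁ j p ⁻¹' S₁ (j + 1), dist u y < ε)
    (f₂ : ℕ → α → E₂ → E₂) (S₂ : ℕ → Set E₂) (hS₂ : S₂ 0 = ∅)
    (hfin₂ : ∀ j < k, ∀ p ∈ P j, (f₂ j p ⁻¹' S₂ (j + 1)).Finite)
    (hpers₂ : ∀ j < k, ∀ p ∈ P j, ∀ p' ∈ P j, p ≠ p' → ∀ y,
      f₂ j p y ∈ S₂ (j + 1) → f₂ j p' y ∈ S₂ (j + 1) → y ∈ S₂ j)
    (hloc₂ : ∀ j < k, ∀ p ∈ P j, ∀ ε > 0, ∃ δ > 0, ∀ u, (∃ x ∈ S₂ (j + 1), dist (f₂ j p u) x < δ) →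
      ∃ y ∈ f₂ j p ⁻¹' S₂ (j + 1), dist u y < ε) :
    ∃ r₁ > 0, ∃ r₂ > 0, ∀ (Z₁ : Finset E₁) (Z₂ : Finset E₂),
      (∀ j < k, Z₁.card + Z₂.card < (P j).card) →
      ∃ c : ℕ → α, (∀ j < k, c j ∈ P j) ∧
        (∀ z ∈ Z₁, ∀ x ∈ S₁ k, r₁ ≤ dist ((List.range k).foldl (fun z i => f₁ i (c i) z) z) x) ∧
        (∀ z ∈ Z₂, ∀ x ∈ S₂ k, r₂ ≤ dist ((List.range k).foldl (fun z i => f₂ i (c i) z) z) x) := by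
  classical
  obtain ⟨ρ₁, hρ₁, hchain₁⟩ := exists_radii_chain k P f₁ S₁ hfin₁ hpers₁ hloc₁
  obtain ⟨ρ₂, hρ₂, hchain₂⟩ := exists_radii_chain k P f₂ S₂ hfin₂ hpers₂ hloc₂
  refine ⟨ρ₁ k, hρ₁ k, ρ₂ k, hρ₂ k, fun Z₁ Z₂ hZ => ?_⟩
  -- both kinds of slots in the sum type
  let g : ℕ → α → E₁ ⊕ E₂ → E₁ ⊕ E₂ := fun j a s =>
    match s with
    | Sum.inl z => Sum.inl (f₁ j a z)
    | Sum.inr z => Sum.inr (f₂ j a z)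
  let Near : ℕ → E₁ ⊕ E₂ → Prop := fun j s =>
    match s with
    | Sum.inl z => ∃ x ∈ S₁ j, dist z x < ρ₁ j
    | Sum.inr z => ∃ x ∈ S₂ j, dist z x < ρ₂ j
  have hg₁ : ∀ j a (z : E₁), g j a (Sum.inl z) = Sum.inl (f₁ j a z) := fun _ _ _ => rfl
  have hg₂ : ∀ j a (z : E₂), g j a (Sum.inr z) = Sum.inr (f₂ j a z) := fun _ _ _ => rfl
  have hcard : (Z₁.disjSum Z₂).card = Z₁.card + Z₂.card := Finset.card_disjSum _ _
  obtain ⟨c, hc, hgood⟩ := exists_good_menu_abstract k P g Near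
    (by
      intro j hj s hs p hp p' hp' hn hn'
      by_contra hne
      rcases s with z | z
      · exact hs (hchain₁ j hj z p hp p' hp' hne hn hn')
      · exact hs (hchain₂ j hj z p hp p' hp' hne hn hn'))
    (Z₁.disjSum Z₂)
    (by
      intro s _
      rcases s with z | z
      · change ¬ ∃ x ∈ S₁ 0, dist z x < ρ₁ 0
        simp [hS₁]
      · change ¬ ∃ x ∈ S₂ 0, dist z x < ρ₂ 0
        simp [hS₂])
    (by intro j hj; rw [hcard]; exact hZ j hj)
  have hit₁ : ∀ z : E₁, (List.range k).foldl (fun s i => g i (c i) s) (Sum.inl z) =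
      Sum.inl ((List.range k).foldl (fun z i => f₁ i (c i) z) z) := fun z =>
    (comp_map f₁ g Sum.inl (fun j a s => (hg₁ j a s).symm) c k z).symm
  have hit₂ : ∀ z : E₂, (List.range k).foldl (fun s i => g i (c i) s) (Sum.inr z) =
      Sum.inr ((List.range k).foldl (fun z i => f₂ i (c i) z) z) := fun z =>
    (comp_map f₂ g Sum.inr (fun j a s => (hg₂ j a s).symm) c k z).symm
  refine ⟨c, hc, fun z hz x hx => ?_, fun z hz x hx => ?_⟩
  · have h := hgood (Sum.inl z) (Finset.inl_mem_disjSum.mpr hz)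
    rw [hit₁] at h
    by_contra hlt
    exact h ⟨x, hx, lt_of_not_ge hlt⟩
  · have h := hgood (Sum.inr z) (Finset.inr_mem_disjSum.mpr hz)
    rw [hit₂] at h
    by_contra hlt
    exact h ⟨x, hx, lt_of_not_ge hlt⟩

/-- **NESTED MENU COVERING LEMMA, any family of slot spaces** (one metric space `E v` per place `v` of a
set `V` of places — e.g. `V = {∞} ∪ S_bad`, `E ∞ = ℂ`, `E p = Q̄_p` — all moved by the SAME parameter
choice; slots are points of the disjoint union `Σ v, E v`): with the per-level hypotheses in each space
(`S v 0 = ∅`), there are radii `r v > 0` such that for every finite slot set `Z ⊆ Σ v, E v` with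
`#Z < #(P j)` for all `j`, some `c j ∈ P j` makes the full composite of every slot `⟨v, z⟩ ∈ Z` `r v`-far
from `S v k`.  (`exists_good_menu₂` is the case `V = Fin 2` up to the `Sum`/`Sigma` encoding.)
[cite: MochizukiGenEll2010, Thm 2.1 p.12] -/
theorem exists_good_menu_family {V : Type*} {F : V → Type*} [∀ v, MetricSpace (F v)] [Inhabited α]
    (k : ℕ) (P : ℕ → Finset α) (f : ∀ v, ℕ → α → F v → F v) (S : ∀ v, ℕ → Set (F v))
    (hS0 : ∀ v, S v 0 = ∅)
    (hfin : ∀ v, ∀ j < k, ∀ p ∈ P j, (f v j p ⁻¹' S v (j + 1)).Finite)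
    (hpers : ∀ v, ∀ j < k, ∀ p ∈ P j, ∀ p' ∈ P j, p ≠ p' → ∀ y,
      f v j p y ∈ S v (j + 1) → f v j p' y ∈ S v (j + 1) → y ∈ S v j)
    (hloc : ∀ v, ∀ j < k, ∀ p ∈ P j, ∀ ε > 0, ∃ δ > 0, ∀ u,
      (∃ x ∈ S v (j + 1), dist (f v j p u) x < δ) → ∃ y ∈ f v j p ⁻¹' S v (j + 1), dist u y < ε) :
    ∃ r : V → ℝ, (∀ v, 0 < r v) ∧ ∀ Z : Finset (Σ v, F v), (∀ j < k, Z.card < (P j).card) →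
      ∃ c : ℕ → α, (∀ j < k, c j ∈ P j) ∧
        ∀ z ∈ Z, ∀ x ∈ S z.1 k, r z.1 ≤ dist ((List.range k).foldl (fun w i => f z.1 i (c i) w) z.2) x := by
  classical
  have hch := fun v => exists_radii_chain k P (f v) (S v) (hfin v) (hpers v) (hloc v)
  choose ρ hρ hchain using hch
  refine ⟨fun v => ρ v k, fun v => hρ v k, fun Z hZ => ?_⟩
  -- all slots in the `Sigma` type
  let g : ℕ → α → (Σ v, F v) → (Σ v, F v) := fun j a s => ⟨s.1, f s.1 j a s.2⟩
  let Near : ℕ → (Σ v, F v) → Prop := fun j s => ∃ x ∈ S s.1 j, dist s.2 x < ρ s.1 j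
  obtain ⟨c, hc, hgood⟩ := exists_good_menu_abstract k P g Near
    (by
      intro j hj s hs p hp p' hp' hn hn'
      by_contra hne
      exact hs (hchain s.1 j hj s.2 p hp p' hp' hne hn hn'))
    Z
    (by
      intro s _
      change ¬ ∃ x ∈ S s.1 0, dist s.2 x < ρ s.1 0
      simp [hS0])
    hZ
  have hit : ∀ (v : V) (z : F v), (List.range k).foldl (fun s i => g i (c i) s) ⟨v, z⟩ =
      ⟨v, (List.range k).foldl (fun w i => f v i (c i) w) z⟩ := fun v z =>
    (comp_map (f v) g (fun w => (⟨v, w⟩ : Σ v, F v)) (fun _ _ _ => rfl) c k z).symm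
  refine ⟨c, hc, fun z hz x hx => ?_⟩
  obtain ⟨v, z⟩ := z
  have h := hgood ⟨v, z⟩ hz
  rw [hit] at h
  by_contra hlt
  exact h ⟨x, hx, lt_of_not_ge hlt⟩

end Metric

end Summit.ABC.ABC.Theorems.GenEllTwo.MenuCoveringNested

end
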